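/-
Copyright (c) 2026. All rights reserved.
Released under Apache 2.0 license as described in the file LICENSE.
Authors: abc-iut cell, statement-typer seat abc-iut-L4-t3 (wave 1).
-/
import Literature.AnabelianGeometry.AbsoluteAnabelian.LogFrobeniusPanalocalizationCoherence
import HarnessLib

/-!
# [AbsTopIII] Corollary 5.5 (vi), telecore clause: the three coherences are jointly satisfiable (anonymous identity witness)

S. Mochizuki, *Topics in absolute anabelian geometry III: global reconstruction algorithms*,
J. Math. Sci. Univ. Tokyo 22 (2015) 939–1156 [MochizukiAbsTopIII2015]; Cor 5.5 (ii) p. 130, (vi) p. 132, Def 5.1 (vi) p. 118.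

Non-vacuity companion of `LogFrobeniusPanalocalizationCoherence.lean` (this seat), in the ANONYMOUS-WITNESS form of
abc-iut-w4-d095 / abc-iut-w5-d053 (the identity panalocalization rebuilt inside the proof, identified by `panT = 𝟭`,
`pan = 𝟭`; no new declaration): at every log-Frobenius setting `L` some panalocalization `L → L` satisfies
`CompatibleWithTelecoreData ∧ OverLog ∧ ∀ v ν, OverLam v ν`, hence (for `V(F_mod) ≠ ∅`) the typed telecore clause of
Cor 5.5 (vi) through `cor55PanalocalizationTelecore_of_coherence`.  (The NAMED form, over `Panalocalization.identity`,
is `LogFrobeniusPanalocalizationCoherenceIdentity.lean`.)  HONEST LABEL: consistency witness at `L₁ = L₂`; nothing here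
bears on [IUTchIII] Cor. 3.12; typed ≠ proved.
-/

set_option autoImplicit false

noncomputable section

universe u

open CategoryTheory Quiver

namespace Literature.AnabelianGeometry.AbsoluteAnabelian

namespace Panalocalization

open DiagramOfCategories LogFrobeniusSetting

variable {Vmod : Type u} {isArc : Vmod → Bool} (L : LogFrobeniusSetting Vmod isArc)

/-- **the three coherences are jointly satisfiable at every setting**: the identity panalocalization (all 2-cells unitor
composites) is compatible with the telecore and contact structures and lies over `𝒳` along `log` and `λ⊞_{v,ν}`.
[cite: MochizukiAbsTopIII2015, Cor 5.5 (vi) p. 132] -/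
theorem exists_self_coherence :
    ∃ P : Panalocalization L L, P.panT = 𝟭 _ ∧ P.pan = 𝟭 _ ∧ P.CompatibleWithTelecoreData ∧ P.OverLog ∧
      ∀ (v : Vmod) (ν : LogVertex (isArc v)), P.OverLam v ν := by
  let P : Panalocalization L L :=
    { panT := 𝟭 _
      pan := 𝟭 _
      over := L.proj.leftUnitor ≪≫ L.proj.rightUnitor.symm
      panNplus := fun _ => 𝟭 _
      panN := fun _ => 𝟭 _
      panAn := 𝟭 _
      panNmonoPlus := fun _ => 𝟭 _
      panNmono := fun _ => 𝟭 _
      panEmono := 𝟭 _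
      panAnMono := 𝟭 _
      isoLog := L.log.leftUnitor ≪≫ L.log.rightUnitor.symm
      isoLam := fun v ν => (L.lam v ν).leftUnitor ≪≫ (L.lam v ν).rightUnitor.symm
      isoForget := fun v => (L.forget v).leftUnitor ≪≫ (L.forget v).rightUnitor.symm
      isoToE := fun v => (L.toE v).leftUnitor ≪≫ (L.toE v).rightUnitor.symm
      isoκAn := L.κAn.functor.leftUnitor ≪≫ L.κAn.functor.rightUnitor.symm
      isoAnToE := L.κAn₂.functor.leftUnitor ≪≫ L.κAn₂.functor.rightUnitor.symm
      isoMonoNplus := fun v => (L.monoNplus v).leftUnitor ≪≫ (L.monoNplus v).rightUnitor.symm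
      isoMonoN := fun v => (L.monoN v).leftUnitor ≪≫ (L.monoN v).rightUnitor.symm
      isoMonoE := L.monoAn.leftUnitor ≪≫ L.monoAn.rightUnitor.symm
      isoMonoAn := (L.κAn.inverse ⋙ L.monoAn ⋙ L.κAnMono.functor).leftUnitor ≪≫
      (L.κAn.inverse ⋙ L.monoAn ⋙ L.κAnMono.functor).rightUnitor.symm
      isoForgetMono := fun w => (L.forgetMono w).leftUnitor ≪≫ (L.forgetMono w).rightUnitor.symm
      isoToEmono := fun w => (L.toEmono w).leftUnitor ≪≫ (L.toEmono w).rightUnitor.symm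
      isoκAnMono := L.κAnMono.functor.leftUnitor ≪≫ L.κAnMono.functor.rightUnitor.symm
      isoAnMonoToE := L.κAnMono.inverse.leftUnitor ≪≫ L.κAnMono.inverse.rightUnitor.symm
      isoφAn := L.φAn.leftUnitor ≪≫ L.φAn.rightUnitor.symm
      panNmonoPlus_isEquivalence := fun _ => inferInstance
      panNmono_isEquivalence := fun _ => inferInstance
      panEmono_isEquivalence := inferInstance
      panAnMono_isEquivalence := inferInstance }
  refine ⟨P, rfl, rfl, ?_, ?_, ?_⟩
  · unfold CompatibleWithTelecoreData
    ext x
    simp [telecoreComparison, P]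
    repeat (first | erw [L.κAn.functor.map_id] | erw [L.φAn.map_id] | erw [Category.id_comp])
    rfl
  · intro x
    simp only [P, Iso.trans_hom, Iso.symm_hom, NatTrans.comp_app, Functor.leftUnitor_hom_app,
      Functor.rightUnitor_inv_app, Functor.id_map]
    repeat (first | erw [Category.id_comp] | erw [Category.comp_id])
    rfl
  · intro v ν x
    simp only [P, Iso.trans_hom, Iso.symm_hom, NatTrans.comp_app, Functor.leftUnitor_hom_app,
      Functor.rightUnitor_inv_app, Functor.id_map]
    repeat (first
      | erw [Category.id_comp]
      | erw [Category.comp_id]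
      | erw [(L.forget v).map_id]
      | erw [(L.toE v).map_id])
    rfl

/-- hence, for `V(F_mod) ≠ ∅`, some panalocalization `L → L` with `panT = 𝟭` satisfies the typed telecore clause of
Cor 5.5 (vi) THROUGH the three coherences. [cite: MochizukiAbsTopIII2015, Cor 5.5 (vi) p. 132] -/
theorem exists_self_cor55PanalocalizationTelecore_of_coherence [Nonempty Vmod] :
    ∃ P : Panalocalization L L, P.panT = 𝟭 _ ∧ P.Cor55PanalocalizationTelecore := by
  obtain ⟨P, hT', -, hT, hlog, hlam⟩ := exists_self_coherence L
  exact ⟨P, hT', P.cor55PanalocalizationTelecore_of_coherence hT hlog hlam⟩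

end Panalocalization

end Literature.AnabelianGeometry.AbsoluteAnabelian

end
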